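import Summits.BirchSwinnertonDyer.BirchSwinnertonDyer.Theorems.ManinLocalTwoThreeReducibleThreeTorsionLiftC
import Summits.BirchSwinnertonDyer.BirchSwinnertonDyer.Theorems.ManinLocalTwoThreeKummerCoverNotGammaOneReal
import Summits.BirchSwinnertonDyer.Rank1Residual.ManinAdditive.UDCKummerLineK
import HarnessLib

/-!
# K-LINE nodes BY NAME: EXISTC is a THEOREM; GENΣ holds on the real locus (lead p1 g16)
(route `ManinLocalTwoThree`, crux C3 `ManinPrimeToThreeAtNine` stmt-BirchSwinnertonDyer-22968; cell bsd-f2-manin; `--supports stmt-BirchSwinnertonDyer-22968`;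
by-name wrappers of the lead's def-free theorems onto -an g39's K-LINE statement layer `ManinAdditive/UDCKummerLineK.lean` (ty g21, T-an-47))

* **`reducibleShortThreeTorsionLiftC_holds : UDCKummerLineK.ReducibleShortThreeTorsionLiftC`** — EXISTC, unconditional
  (`KummerCover.exists_shortThreeTorsionC_lift`, p735052; `IsShortThreeTorsionC` unfolds definitionally).
* **`kummerNotShimuraOfGeneric_of_im_eq_zero`** — GENΣ `KummerNotShimuraOfGeneric` on the REAL locus `im Y₀ = 0` with the non-rationality and
  non-`μ₃` clauses not even needed: `¬ KummerShimura D u` for every lift `u` of a `3`-torsion point with real ordinate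
  (`KummerCover.exists_mem_gamma1_not_kummerPeriodTrivial_of_im_eq_zero`, p734511, unconditional); `not_kummerShimura_of_derivWeierstrassP_real` is
  the lift-only form (`im ℘'(u) = 0`).  The IMAGINARY non-`μ₃` locus of GENΣ is -an's edge `kummerNotShimuraOfGeneric_of_muType` from E-an-201.
HONEST FRAMING.  RES₃♭, C3, Manin's conjecture and BSD are NOT proved (OPEN).  No definitions, no sorry.
[folklore]
-/

set_option autoImplicit false
-- lint-debt: the directory name repeats the summit name (sibling precedent `ManinLocalTwoThreeKummerCoverNotGammaOne.lean`)
set_option linter.dupNamespace false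

noncomputable section

open scoped MatrixGroups PeriodPair
open CongruenceSubgroup WeierstrassCurve Literature.NumberTheory.EllipticCurves Literature.NumberTheory.EllipticCurves.ModularForms
open Summit.BirchSwinnertonDyer.Rank1Residual.ManinAdditive.CuspidalKummerThree
open Summit.BirchSwinnertonDyer.Rank1Residual.ManinAdditive.UDCKummerLine
open Summit.BirchSwinnertonDyer.Rank1Residual.ManinAdditive.UDCKummerLineK

namespace Summit.BirchSwinnertonDyer.BirchSwinnertonDyer.Theorems.ManinLocalTwoThree.KummerCover

/-- **EXISTC BY NAME — `ReducibleShortThreeTorsionLiftC` is a THEOREM** (the lead's `exists_shortThreeTorsionC_lift`, p735052). [folklore] -/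
theorem reducibleShortThreeTorsionLiftC_holds : ReducibleShortThreeTorsionLiftC :=
  fun W _ _ _ _ D hred hT ↦ exists_shortThreeTorsionC_lift W D hred hT

/-- **GENΣ, lift-only real form**: for a lattice-optimal datum at `9 ∣ N`, a third-period `u ∉ Λ_E` with `℘'(u)` REAL is not Kummer–Shimura
(some `γ ∈ Γ₁(N)` has a non-trivial Kummer period). [folklore] -/
theorem not_kummerShimura_of_derivWeierstrassP_real (W : WeierstrassCurve ℚ) [W.IsElliptic] [W.IsGloballyMinimal]
    {N : ℕ} [NeZero N] (D : ModularParametrizationData W N) (h9 : 3 ^ 2 ∣ N)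
    (hopt : ∀ z ∈ D.L.lattice, ∃ w ∈ periodLattice D.f, z = D.c * w)
    {u : ℂ} (hu : u ∉ D.L.lattice) (h3u : 3 * u ∈ D.L.lattice) (hreal : (℘'[D.L] u).im = 0) :
    ¬ KummerShimura D u := by
  intro hS
  have h9' : 9 ∣ N := by norm_num at h9; exact h9
  obtain ⟨γ, hγ, hne⟩ := exists_mem_gamma1_not_kummerPeriodTrivial_of_real W D h9' hopt hu h3u hreal
  exact hne (hS γ hγ)

/-- **GENΣ BY NAME ON THE REAL LOCUS**: -an's `KummerNotShimuraOfGeneric` with the extra binder `im Y₀ = 0` (and its non-rationality / non-`μ₃`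
clauses unused): a `3`-torsion point of the short model with REAL ordinate and any analytic lift `u` is not Kummer–Shimura. [folklore] -/
theorem kummerNotShimuraOfGeneric_of_im_eq_zero (W : WeierstrassCurve ℚ) [W.IsElliptic] [W.IsGloballyMinimal]
    {N : ℕ} [NeZero N] (D : ModularParametrizationData W N)
    (hopt : ∀ z ∈ D.L.lattice, ∃ w ∈ periodLattice D.f, z = D.c * w) (h9 : 3 ^ 2 ∣ N)
    (X₀ : ℚ) (Y₀ : ℂ) (_hT : IsShortThreeTorsionC W D.c X₀ Y₀) (hY₀ : Y₀.im = 0)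
    (u : ℂ) (hu : u ∉ D.L.lattice) (h3u : 3 * u ∈ D.L.lattice)
    (_hX : (D.c : ℂ) ^ 2 * ℘[D.L] u = (X₀ : ℂ)) (hY : (D.c : ℂ) ^ 3 * ℘'[D.L] u / 2 = Y₀) :
    ¬ KummerShimura D u := by
  intro hS
  obtain ⟨γ, hγ, hne⟩ := exists_mem_gamma1_not_kummerPeriodTrivial_of_im_eq_zero W D hopt h9 Y₀ hY₀ hu h3u hY
  exact hne (hS γ hγ)

end Summit.BirchSwinnertonDyer.BirchSwinnertonDyer.Theorems.ManinLocalTwoThree.KummerCover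

end
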